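import Summits.CriticalPhenomena.PercolationContinuityZ3.Theorems.PercNearOneGluingNoHeavyLowerTailQ7PsiSetObserverDom
import HarnessLib

/-!
# `NoHeavyLowerTail` (stmt-CriticalPhenomena-4575) — the observer half of the set-observer certificate from the
# set-observer marker dominance lemma (Kozma–Nitzan Question 9 at `|A| = 3`: step B5)

Support file (`--supports stmt-CriticalPhenomena-4575`), coupling seat `prim-cplus-coupling` (gen 13).  No
definitions, no named facts, no sorries.  Memo A5-COUPLING-gen13.md §3.3 (blueprint step B5; B6 = `…Q7PsiSetObserverDom.lean`).

Notation (one bond percolation `μ`, observer SET `N`, strong relays `x, y`, weak relay `z`; `v ↔ N := ∃ n ∈ N, v ↔ n`):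
`D = {x↮z}`, `E1 = {x↮y} ∩ D`, `E2 = {y↮x} ∩ {y↮z}`, `Y = {x↔y}`, `W1 = {x↔N} ∩ {y↮N} ∩ {z↮N}` (mass `a`),
`W2 = {y↔N} ∩ {x↮N} ∩ {z↮N}` (mass `b`), `O = {x↔N} ∩ {z↮N}` (mass `o = a + d + e` of the memo).
* `Q7Psi.setSep_offCluster_posCorrelation_event` — BHK Thm 1.3 given `{s ↮ X}` for `F(C_s)` against the product of an
  increasing cluster event and a decreasing off-cluster statistic (the pattern of `setSep_offCluster_posCorrelation` with an
  extra cluster factor); it gives `(∫_{E1} F(C_x)) · μ(W1) ≤ μ(E1) · ∫_{W1} F(C_x)` although `𝟙_{W1}` itself is not monotone.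
* `Q7Psi.hx_set_of_setMDL` — **the observer half (H_x)** `λ ∫_D F(C_x) ≤ (1−t) ∫_{W1} F(C_x) + t ∫_O F(C_x)` at the census
  split `t (a μ(E2) + b μ(E1)) = a μ(E2)` and multiplier `λ μ(D) = (1−t) a + t o`, FROM the set-observer marker dominance
  lemma at this `F`: `b · cov_D(F(C_x), Y) ≤ μ(E2) · cov_D(F(C_x), O)` (`cov_D` denominator-free) — the one new atom of the
  programme (memo §3.3; census 0 / 4,600; its `z`-free case is `Q7Psi.setObs_cov_ge`).  Identity:
  `e1 e2 · T = t e1 · (MDL) + (1−t) e2 μ(D) · (BHK) + cov_D(F, Y) · (t e1 b − (1−t) e2 a)`, last term `= 0`.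
For `N = {o}` this is `Q7Psi.p1star_of_cov`.
[cite: KozmaNitzan2024, §5.1 (pp. 31–32), Question 9 (p. 36)] [cite: VandenbergHaggstromKahn2005, Thm 1.3 (p. 6), §1 pp. 7–8]
-/

namespace Summit.CriticalPhenomena.PercolationContinuityZ3.Theorems

open MeasureTheory Set Literature.Probability.LatticeModels Literature.Probability.Percolation
open scoped Classical
open KNPreFKG BHK2006 DecisionTree LonePortSum LonePortSumGeneral

noncomputable section

namespace Q7Psi

variable {V : Type*} [Fintype V]

/-- **Cluster / (cluster event × off-cluster statistic) positive correlation given `{s ↮ X}`.**  For `s ∉ X`, `F`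
monotone, `Φ ≥ 0` monotone (both applied to `C_s`), and `G ≥ 0` antitone with the locality property
`G(ω ∖ W̄(C_s ω)) = G(ω)` on `D_X = {s ↮ X}`:
`(∫_{D_X} F(C_s)) · (∫_{D_X} Φ(C_s) G) ≤ μ(D_X) · ∫_{D_X} F(C_s) Φ(C_s) G`.
Proof: `∫_{D_X} (F)·Φ(C_s) G = ∫_{D_X} (F)·ψ(C_s)` with `ψ(W) = Φ(W) Σ_η w(η) G(η ∖ W̄)` INCREASING (display (10) +
locality), then BHK Thm 1.3 for the pair `(F, ψ)`. [cite: VandenbergHaggstromKahn2005, Thm. 1.3 (p. 6) and pp. 7–8 — corollary] -/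
theorem setSep_offCluster_posCorrelation_event (w : Sym2 V → unitInterval) (s : V) (X : Set V)
    (hs : s ∉ X) (F : Set (Sym2 V) → ℝ) (hF : Monotone F) (Φ : Set (Sym2 V) → ℝ) (hΦ : Monotone Φ)
    (hΦ0 : ∀ C, 0 ≤ Φ C) (G : BondConfig V → ℝ) (hG : Antitone G) (hG0 : ∀ ω, 0 ≤ G ω)
    (hloc : ∀ ω : BondConfig V, (∀ x ∈ X, ¬ (openGraph ω).Reachable s x) →
      G (ω \ {e | ∃ v ∈ e, v = s ∨ ∃ e' ∈ openEdgeCluster ω s, v ∈ e'}) = G ω) :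
    (∫ ω in {ω : BondConfig V | ∀ x ∈ X, ¬ (openGraph ω).Reachable s x},
        F (openEdgeCluster ω s) ∂(prodBernoulli w)) *
      (∫ ω in {ω : BondConfig V | ∀ x ∈ X, ¬ (openGraph ω).Reachable s x},
        Φ (openEdgeCluster ω s) * G ω ∂(prodBernoulli w)) ≤
    (prodBernoulli w).real {ω : BondConfig V | ∀ x ∈ X, ¬ (openGraph ω).Reachable s x} *
      ∫ ω in {ω : BondConfig V | ∀ x ∈ X, ¬ (openGraph ω).Reachable s x},
        F (openEdgeCluster ω s) * (Φ (openEdgeCluster ω s) * G ω) ∂(prodBernoulli w) := by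
  classical
  set DX : Set (BondConfig V) := {ω | ∀ x ∈ X, ¬ (openGraph ω).Reachable s x} with hDX
  set w' : Sym2 V → ℝ := fun e => (w e : ℝ) with hw'
  have hw0 : ∀ e, 0 ≤ w' e := fun e => (w e).2.1
  have hw1 : ∀ e, w' e ≤ 1 := fun e => (w e).2.2
  have hm : ∑ ω, weight w' ω = 1 := by
    have h1 := integral_prodBernoulli_eq_sum w fun _ => (1 : ℝ)
    simp only [integral_const, probReal_univ, smul_eq_mul, mul_one] at h1
    exact h1.symm
  -- `1_{D_X} = NX(C_s)`
  set NX : Set (Sym2 V) → ℝ := fun C => if ∀ x ∈ X, ¬ (x = s ∨ ∃ e ∈ C, x ∈ e) then 1 else 0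
    with hNX
  have hind : ∀ ω : BondConfig V, ind DX ω = NX (openEdgeCluster ω s) := by
    intro ω
    by_cases hω : ω ∈ DX
    · have hω' : ∀ x ∈ X, ¬ (openGraph ω).Reachable s x := hω
      have h1 : ∀ x ∈ X, ¬ (x = s ∨ ∃ e ∈ openEdgeCluster ω s, x ∈ e) := fun x hx h =>
        hω' x hx ((reachable_iff_exists_mem_openEdgeCluster ω s x).2 h)
      rw [ind_of_mem hω, hNX]
      simp only [if_pos h1]
    · have hω' : ∃ x ∈ X, (openGraph ω).Reachable s x := by
        by_contra hcon
        exact hω fun x hx hr => hcon ⟨x, hx, hr⟩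
      obtain ⟨x, hx, hr⟩ := hω'
      have h1 : ¬ ∀ x ∈ X, ¬ (x = s ∨ ∃ e ∈ openEdgeCluster ω s, x ∈ e) := fun h =>
        h x hx ((reachable_iff_exists_mem_openEdgeCluster ω s x).1 hr)
      rw [ind_of_not_mem hω, hNX]
      simp only [if_neg h1]
  have hptw : ∀ ω : BondConfig V, G ω * ind DX ω =
      NX (openEdgeCluster ω s) *
        G (ω \ {e | ∃ v ∈ e, v = s ∨ ∃ e' ∈ openEdgeCluster ω s, v ∈ e'}) := by
    intro ω
    rw [hind ω]
    by_cases hω : ω ∈ DX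
    · rw [hloc ω hω, mul_comm]
    · have h0 : NX (openEdgeCluster ω s) = 0 := by rw [← hind ω, ind_of_not_mem hω]
      rw [h0, zero_mul, mul_zero]
  -- `ψ(W) = Φ(W) · E[G(η ∖ W̄)]`, increasing in `W`
  set ψ0 : Set (Sym2 V) → ℝ := fun W => ∑ η, weight w' η *
      G (η \ {e | ∃ v ∈ e, v = s ∨ ∃ e' ∈ W, v ∈ e'}) with hψ0
  have hψ0mono : Monotone ψ0 := by
    intro W W' hWW'
    refine Finset.sum_le_sum fun η _ => mul_le_mul_of_nonneg_left ?_ (weight_nonneg hw0 hw1 η)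
    exact hG (Set.sdiff_subset_sdiff_right (bar_mono s hWW'))
  have hψ0nn : ∀ W, 0 ≤ ψ0 W := fun W =>
    Finset.sum_nonneg fun η _ => mul_nonneg (weight_nonneg hw0 hw1 η) (hG0 _)
  set ψ : Set (Sym2 V) → ℝ := fun W => Φ W * ψ0 W with hψ
  have hψmono : Monotone ψ := fun W W' hWW' =>
    mul_le_mul (hΦ hWW') (hψ0mono hWW') (hψ0nn W) (hΦ0 W')
  -- display (10) for `K = F · Φ · NX · G` and for `K = Φ · NX · G`
  have e1 := sum_cond_cluster_sdiff w' hm s (fun C ξ => F C * Φ C * NX C * G ξ)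
  have e2 := sum_cond_cluster_sdiff w' hm s (fun C ξ => Φ C * NX C * G ξ)
  have i1 : ∫ ω in DX, F (openEdgeCluster ω s) * (Φ (openEdgeCluster ω s) * G ω) ∂(prodBernoulli w) =
      ∫ ω in DX, F (openEdgeCluster ω s) * ψ (openEdgeCluster ω s) ∂(prodBernoulli w) := by
    rw [setIntegral_eq_sum w DX, setIntegral_eq_sum w DX]
    have lhs : ∑ ω, weight w' ω * (F (openEdgeCluster ω s) * (Φ (openEdgeCluster ω s) * G ω) * ind DX ω) =
        ∑ ω, weight w' ω * ((fun C ξ => F C * Φ C * NX C * G ξ) (openEdgeCluster ω s)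
          (ω \ {e | ∃ v ∈ e, v = s ∨ ∃ e' ∈ openEdgeCluster ω s, v ∈ e'})) :=
      Finset.sum_congr rfl fun ω _ => by
        simp only
        rw [show F (openEdgeCluster ω s) * (Φ (openEdgeCluster ω s) * G ω) * ind DX ω =
          F (openEdgeCluster ω s) * Φ (openEdgeCluster ω s) * (G ω * ind DX ω) by ring, hptw ω]
        ring
    rw [lhs, e1]
    refine Finset.sum_congr rfl fun ω _ => ?_
    rw [hind ω, hψ]
    simp only [hψ0, Finset.mul_sum, Finset.sum_mul]
    refine Finset.sum_congr rfl fun η _ => ?_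
    ring
  have i2 : ∫ ω in DX, Φ (openEdgeCluster ω s) * G ω ∂(prodBernoulli w) =
      ∫ ω in DX, ψ (openEdgeCluster ω s) ∂(prodBernoulli w) := by
    rw [setIntegral_eq_sum w DX, setIntegral_eq_sum w DX]
    have lhs : ∑ ω, weight w' ω * (Φ (openEdgeCluster ω s) * G ω * ind DX ω) =
        ∑ ω, weight w' ω * ((fun C ξ => Φ C * NX C * G ξ) (openEdgeCluster ω s)
          (ω \ {e | ∃ v ∈ e, v = s ∨ ∃ e' ∈ openEdgeCluster ω s, v ∈ e'})) :=
      Finset.sum_congr rfl fun ω _ => by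
        simp only
        rw [mul_assoc, hptw ω]
        ring
    rw [lhs, e2]
    refine Finset.sum_congr rfl fun ω _ => ?_
    rw [hind ω, hψ]
    simp only [hψ0, Finset.mul_sum, Finset.sum_mul]
    refine Finset.sum_congr rfl fun η _ => ?_
    ring
  have h13 := BHK2006_clusterConditionalPositiveAssociation_holds V w s X F ψ hF hψmono hs
  rw [i2, i1]
  exact h13


/-- **The observer half (H_x) of the set-observer certificate from the set-observer marker dominance lemma.**
Notation as in the file header (`D = {x↮z}`, `E1 = {x↮y} ∩ D`, `E2 = {y↮x} ∩ {y↮z}`, `Y = {x↔y}`,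
`W1 = {x↔N} ∩ {y↮N} ∩ {z↮N}` of mass `a`, `W2` of mass `b`, `O = {x↔N} ∩ {z↮N}` of mass `o`).  If
`t (a μ(E2) + b μ(E1)) = a μ(E2)` with `0 ≤ t ≤ 1`, `λ μ(D) = (1−t) a + t o`, `μ(E1), μ(E2) > 0`, and the set-observer
marker dominance lemma holds at the monotone `F`:
`b · [μ(D) ∫_{Y∩D} F(C_x) − μ(Y∩D) ∫_D F(C_x)] ≤ μ(E2) · [μ(D) ∫_O F(C_x) − μ(O) ∫_D F(C_x)]`,
then `λ ∫_D F(C_x) ≤ (1−t) ∫_{W1} F(C_x) + t ∫_O F(C_x)`.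
Proof: the identity `e1 e2·T = t e1·(MDL) + (1−t) e2 μ(D)·(BHK) + cov_D(F,Y)·(t e1 b − (1−t) e2 a)` with (BHK)
`a ∫_{E1} F ≤ μ(E1) ∫_{W1} F` (`setSep_offCluster_posCorrelation_event`: given `x ↮ {y,z}` the cluster of `x` is
positively correlated with `𝟙{x↔N}·𝟙{y↮N, z↮N}`, whose conditional weight is increasing).
[cite: KozmaNitzan2024, §5.1 (pp. 31–32)] [cite: VandenbergHaggstromKahn2005, Thm 1.3 (p. 6), §1 pp. 7–8] -/
theorem hx_set_of_setMDL (w : Sym2 V → unitInterval) (x y z : V) (N : Set V) (hxy : x ≠ y) (hxz : x ≠ z)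
    (F : Set V → ℝ) (hF : ∀ S T : Set V, S ⊆ T → F S ≤ F T) (t lam : ℝ)
    (ht0 : 0 ≤ t) (ht1 : t ≤ 1)
    (hE1 : 0 < (prodBernoulli w).real ({ω : BondConfig V | ¬ (openGraph ω).Reachable x y} ∩
      {ω | ¬ (openGraph ω).Reachable x z}))
    (hE2 : 0 < (prodBernoulli w).real ({ω : BondConfig V | ¬ (openGraph ω).Reachable y x} ∩
      {ω | ¬ (openGraph ω).Reachable y z}))
    (ht : t * ((prodBernoulli w).real ({ω : BondConfig V | ∃ n ∈ N, (openGraph ω).Reachable x n} ∩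
            ({ω | ∀ n ∈ N, ¬ (openGraph ω).Reachable y n} ∩ {ω | ∀ n ∈ N, ¬ (openGraph ω).Reachable z n})) *
          (prodBernoulli w).real ({ω : BondConfig V | ¬ (openGraph ω).Reachable y x} ∩
            {ω | ¬ (openGraph ω).Reachable y z}) +
        (prodBernoulli w).real ({ω : BondConfig V | ∃ n ∈ N, (openGraph ω).Reachable y n} ∩
            ({ω | ∀ n ∈ N, ¬ (openGraph ω).Reachable x n} ∩ {ω | ∀ n ∈ N, ¬ (openGraph ω).Reachable z n})) *
          (prodBernoulli w).real ({ω : BondConfig V | ¬ (openGraph ω).Reachable x y} ∩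
            {ω | ¬ (openGraph ω).Reachable x z})) =
      (prodBernoulli w).real ({ω : BondConfig V | ∃ n ∈ N, (openGraph ω).Reachable x n} ∩
            ({ω | ∀ n ∈ N, ¬ (openGraph ω).Reachable y n} ∩ {ω | ∀ n ∈ N, ¬ (openGraph ω).Reachable z n})) *
        (prodBernoulli w).real ({ω : BondConfig V | ¬ (openGraph ω).Reachable y x} ∩
          {ω | ¬ (openGraph ω).Reachable y z}))
    (hlam : lam * (prodBernoulli w).real {ω : BondConfig V | ¬ (openGraph ω).Reachable x z} =
      (1 - t) * (prodBernoulli w).real ({ω : BondConfig V | ∃ n ∈ N, (openGraph ω).Reachable x n} ∩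
            ({ω | ∀ n ∈ N, ¬ (openGraph ω).Reachable y n} ∩ {ω | ∀ n ∈ N, ¬ (openGraph ω).Reachable z n})) +
        t * (prodBernoulli w).real ({ω : BondConfig V | ∃ n ∈ N, (openGraph ω).Reachable x n} ∩
            {ω | ∀ n ∈ N, ¬ (openGraph ω).Reachable z n}))
    (hcov : (prodBernoulli w).real ({ω : BondConfig V | ∃ n ∈ N, (openGraph ω).Reachable y n} ∩
            ({ω | ∀ n ∈ N, ¬ (openGraph ω).Reachable x n} ∩ {ω | ∀ n ∈ N, ¬ (openGraph ω).Reachable z n})) *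
        ((prodBernoulli w).real {ω : BondConfig V | ¬ (openGraph ω).Reachable x z} *
            (∫ ω in openConn x y ∩ {ω | ¬ (openGraph ω).Reachable x z}, F (openCluster ω x) ∂(prodBernoulli w)) -
          (prodBernoulli w).real (openConn x y ∩ {ω | ¬ (openGraph ω).Reachable x z}) *
            ∫ ω in {ω : BondConfig V | ¬ (openGraph ω).Reachable x z}, F (openCluster ω x) ∂(prodBernoulli w)) ≤
      (prodBernoulli w).real ({ω : BondConfig V | ¬ (openGraph ω).Reachable y x} ∩
          {ω | ¬ (openGraph ω).Reachable y z}) *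
        ((prodBernoulli w).real {ω : BondConfig V | ¬ (openGraph ω).Reachable x z} *
            (∫ ω in {ω : BondConfig V | ∃ n ∈ N, (openGraph ω).Reachable x n} ∩
              {ω | ∀ n ∈ N, ¬ (openGraph ω).Reachable z n}, F (openCluster ω x) ∂(prodBernoulli w)) -
          (prodBernoulli w).real ({ω : BondConfig V | ∃ n ∈ N, (openGraph ω).Reachable x n} ∩
              {ω | ∀ n ∈ N, ¬ (openGraph ω).Reachable z n}) *
            ∫ ω in {ω : BondConfig V | ¬ (openGraph ω).Reachable x z}, F (openCluster ω x) ∂(prodBernoulli w))) :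
    lam * ∫ ω in {ω : BondConfig V | ¬ (openGraph ω).Reachable x z}, F (openCluster ω x) ∂(prodBernoulli w) ≤
      (1 - t) * ∫ ω in {ω : BondConfig V | ∃ n ∈ N, (openGraph ω).Reachable x n} ∩
            ({ω | ∀ n ∈ N, ¬ (openGraph ω).Reachable y n} ∩ {ω | ∀ n ∈ N, ¬ (openGraph ω).Reachable z n}),
          F (openCluster ω x) ∂(prodBernoulli w) +
        t * ∫ ω in {ω : BondConfig V | ∃ n ∈ N, (openGraph ω).Reachable x n} ∩
          {ω | ∀ n ∈ N, ¬ (openGraph ω).Reachable z n}, F (openCluster ω x) ∂(prodBernoulli w) := by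
  classical
  set μ := prodBernoulli w with hμ
  set f : BondConfig V → ℝ := fun ω => F (openCluster ω x) with hf
  set Dxz : Set (BondConfig V) := {ω | ¬ (openGraph ω).Reachable x z} with hDxz
  set Nxy : Set (BondConfig V) := {ω | ¬ (openGraph ω).Reachable x y} with hNxy
  set E2 : Set (BondConfig V) := {ω : BondConfig V | ¬ (openGraph ω).Reachable y x} ∩
    {ω | ¬ (openGraph ω).Reachable y z} with hE2def
  set E1 : Set (BondConfig V) := Nxy ∩ Dxz with hE1def
  set Fev : Set (BondConfig V) := openConn x y ∩ Dxz with hFev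
  set Ox : Set (BondConfig V) := {ω : BondConfig V | ∃ n ∈ N, (openGraph ω).Reachable x n} with hOx
  set Ey : Set (BondConfig V) := {ω | ∀ n ∈ N, ¬ (openGraph ω).Reachable y n} with hEy
  set Ez : Set (BondConfig V) := {ω | ∀ n ∈ N, ¬ (openGraph ω).Reachable z n} with hEz
  set W1 : Set (BondConfig V) := Ox ∩ (Ey ∩ Ez) with hW1
  set O : Set (BondConfig V) := Ox ∩ Ez with hO
  set W2 : Set (BondConfig V) := {ω : BondConfig V | ∃ n ∈ N, (openGraph ω).Reachable y n} ∩
    ({ω | ∀ n ∈ N, ¬ (openGraph ω).Reachable x n} ∩ Ez) with hW2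
  have hmeas : ∀ S : Set (BondConfig V), MeasurableSet S := fun _ => MeasurableSet.of_discrete
  have hint : ∀ (g : BondConfig V → ℝ) (S : Set (BondConfig V)), IntegrableOn g S μ :=
    fun g S => (Integrable.of_finite).integrableOn
  change 0 < μ.real E1 at hE1
  change 0 < μ.real E2 at hE2
  change t * (μ.real W1 * μ.real E2 + μ.real W2 * μ.real E1) = μ.real W1 * μ.real E2 at ht
  change lam * μ.real Dxz = (1 - t) * μ.real W1 + t * μ.real O at hlam
  change μ.real W2 * (μ.real Dxz * (∫ ω in Fev, f ω ∂μ) - μ.real Fev * ∫ ω in Dxz, f ω ∂μ) ≤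
    μ.real E2 * (μ.real Dxz * (∫ ω in O, f ω ∂μ) - μ.real O * ∫ ω in Dxz, f ω ∂μ) at hcov
  show lam * ∫ ω in Dxz, f ω ∂μ ≤ (1 - t) * (∫ ω in W1, f ω ∂μ) + t * ∫ ω in O, f ω ∂μ
  -- (BHK) `(∫_{E1} f) · μ(W1) ≤ μ(E1) · ∫_{W1} f`
  have hxX : x ∉ ({y, z} : Set V) := by
    simp only [mem_insert_iff, mem_singleton_iff, not_or]; exact ⟨hxy, hxz⟩
  have hE1X : {ω : BondConfig V | ∀ v ∈ ({y, z} : Set V), ¬ (openGraph ω).Reachable x v} = E1 := by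
    ext ω
    simp only [mem_insert_iff, mem_singleton_iff, forall_eq_or_imp, forall_eq, mem_setOf_eq, hE1def, hNxy, hDxz,
      mem_inter_iff]
  set NN : Set (Sym2 V) → ℝ := fun C => if ∃ n ∈ N, (n = x ∨ ∃ e ∈ C, n ∈ e) then 1 else 0 with hNN
  have hNNmono : Monotone NN := by
    intro C C' hCC'
    simp only [hNN]
    by_cases h : ∃ n ∈ N, (n = x ∨ ∃ e ∈ C, n ∈ e)
    · have h' : ∃ n ∈ N, (n = x ∨ ∃ e ∈ C', n ∈ e) :=
        h.imp fun n ⟨hn, hc⟩ => ⟨hn, hc.imp id fun ⟨e, he, hne⟩ => ⟨e, hCC' he, hne⟩⟩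
      rw [if_pos h, if_pos h']
    · rw [if_neg h]; split_ifs <;> norm_num
  have hNN0 : ∀ C, 0 ≤ NN C := fun C => by simp only [hNN]; split_ifs <;> norm_num
  have hNNval : ∀ ω : BondConfig V, NN (openEdgeCluster ω x) = ind Ox ω := by
    intro ω
    by_cases hω : ω ∈ Ox
    · obtain ⟨n, hn, hr⟩ := hω
      rw [ind_of_mem (show ω ∈ Ox from ⟨n, hn, hr⟩), hNN]
      simp only
      rw [if_pos ⟨n, hn, (reachable_iff_exists_mem_openEdgeCluster ω x n).1 hr⟩]
    · rw [ind_of_not_mem hω, hNN]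
      simp only
      rw [if_neg]
      rintro ⟨n, hn, hc⟩
      exact hω ⟨n, hn, (reachable_iff_exists_mem_openEdgeCluster ω x n).2 hc⟩
  set G : BondConfig V → ℝ := ind (Ey ∩ Ez) with hG
  have hEyz : IsLowerSet (Ey ∩ Ez) := (isLowerSet_notReachSet y N).inter (isLowerSet_notReachSet z N)
  have hGa : Antitone G := fun ξ ξ' h => ind_anti_of_isLowerSet hEyz h
  have hG0 : ∀ ξ, 0 ≤ G ξ := fun ξ => ind_nonneg _ _
  have hloc : ∀ ω : BondConfig V, (∀ v ∈ ({y, z} : Set V), ¬ (openGraph ω).Reachable x v) →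
      G (ω \ {e | ∃ v ∈ e, v = x ∨ ∃ e' ∈ openEdgeCluster ω x, v ∈ e'}) = G ω := by
    intro ω hω
    have hy' : ¬ (openGraph ω).Reachable x y := hω y (by simp)
    have hz' : ¬ (openGraph ω).Reachable x z := hω z (by simp)
    have key : (ω \ {e | ∃ v ∈ e, v = x ∨ ∃ e' ∈ openEdgeCluster ω x, v ∈ e'}) ∈ Ey ∩ Ez ↔ ω ∈ Ey ∩ Ez := by
      simp only [mem_inter_iff, hEy, hEz, mem_setOf_eq]
      exact and_congr (forall₂_congr fun n _ => not_congr (reachable_sdiff_bar_iff hy' n))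
        (forall₂_congr fun n _ => not_congr (reachable_sdiff_bar_iff hz' n))
    simp only [hG]
    by_cases h : ω ∈ Ey ∩ Ez
    · rw [ind_of_mem h, ind_of_mem (key.2 h)]
    · rw [ind_of_not_mem h, ind_of_not_mem (fun h' => h (key.1 h'))]
  have hB0 := setSep_offCluster_posCorrelation_event w x ({y, z} : Set V) hxX
    (fun C => F {a | a = x ∨ ∃ e ∈ C, a ∈ e}) (monotone_clusterFun x F hF) NN hNNmono hNN0 G hGa hG0 hloc
  simp only [hE1X, clusterFun_openEdgeCluster, hNNval] at hB0
  -- `NN(C_x) · G = 1_{W1}` and `E1 ∩ W1 = W1`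
  have hNG : ∀ ω : BondConfig V, ind Ox ω * G ω = ind W1 ω := by
    intro ω
    simp only [hG]
    by_cases h1 : ω ∈ Ox
    · by_cases h2 : ω ∈ Ey ∩ Ez
      · rw [ind_of_mem h1, ind_of_mem h2, ind_of_mem (show ω ∈ W1 from ⟨h1, h2⟩), one_mul]
      · rw [ind_of_not_mem h2, ind_of_not_mem (show ω ∉ W1 from fun h => h2 h.2), mul_zero]
    · rw [ind_of_not_mem h1, ind_of_not_mem (show ω ∉ W1 from fun h => h1 h.1), zero_mul]
  have hW1E1 : W1 ⊆ E1 := by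
    rintro ω ⟨⟨n, hn, hxn⟩, hy', hz'⟩
    exact ⟨fun hxy' => hy' n hn (hxy'.symm.trans hxn), fun hxz' => hz' n hn (hxz'.symm.trans hxn)⟩
  have hI1 : ∫ ω in E1, ind Ox ω * G ω ∂μ = μ.real W1 := by
    simp_rw [hNG]
    rw [setIntegral_eq_sum w E1]
    have : ∀ ω, ind W1 ω * ind E1 ω = ind W1 ω := fun ω => by
      rw [mul_comm]; exact ind_mul_ind_of_subset hW1E1 ω
    simp_rw [this]
    have h1 := setIntegral_eq_sum w W1 (fun _ => (1 : ℝ))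
    simp only [one_mul] at h1
    rw [← h1, setIntegral_const, smul_eq_mul, mul_one]
  have hI2 : ∫ ω in E1, f ω * (ind Ox ω * G ω) ∂μ = ∫ ω in W1, f ω ∂μ := by
    simp_rw [hNG]
    rw [setIntegral_eq_sum w E1, setIntegral_eq_sum w W1]
    refine Finset.sum_congr rfl fun ω _ => ?_
    rw [mul_assoc, mul_comm (ind W1 ω), ind_mul_ind_of_subset hW1E1 ω]
  rw [hI1, hI2] at hB0
  change (∫ ω in E1, f ω ∂μ) * μ.real W1 ≤ μ.real E1 * ∫ ω in W1, f ω ∂μ at hB0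
  -- event identities: `Dxz = E1 ⊔ Fev`
  have hDsplit : Dxz = E1 ∪ Fev := by
    ext ω
    simp only [hE1def, hFev, hNxy, mem_union, mem_inter_iff, mem_setOf_eq, openConn]
    constructor
    · intro h
      by_cases hr : (openGraph ω).Reachable x y
      · exact Or.inr ⟨hr, h⟩
      · exact Or.inl ⟨hr, h⟩
    · rintro (⟨_, h⟩ | ⟨_, h⟩) <;> exact h
  have hDdisj : Disjoint E1 Fev := by
    rw [Set.disjoint_left]
    rintro ω ⟨hn, _⟩ ⟨hr, _⟩
    exact hn hr
  have hmD : μ.real Dxz = μ.real E1 + μ.real Fev := by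
    rw [hDsplit, measureReal_union hDdisj (hmeas _)]
  have hID : ∫ ω in Dxz, f ω ∂μ = ∫ ω in E1, f ω ∂μ + ∫ ω in Fev, f ω ∂μ := by
    rw [hDsplit, setIntegral_union hDdisj (hmeas _) (hint _ _) (hint _ _)]
  -- abbreviations
  set a := μ.real W1 with ha
  set b := μ.real W2 with hb
  set o := μ.real O with ho
  set e1 := μ.real E1 with he1
  set e2 := μ.real E2 with he2
  set mF := μ.real Fev with hmF
  set Ax := μ.real Dxz with hAx
  set IW1 := ∫ ω in W1, f ω ∂μ
  set IO := ∫ ω in O, f ω ∂μ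
  set IE1 := ∫ ω in E1, f ω ∂μ
  set IF := ∫ ω in Fev, f ω ∂μ
  rw [hID] at hcov
  rw [hID]
  have hAxnn : 0 ≤ Ax := measureReal_nonneg
  have hH1 : 0 ≤ e2 * (Ax * IO - o * (IE1 + IF)) - b * (Ax * IF - mF * (IE1 + IF)) := by linarith
  have hH2 : 0 ≤ e1 * IW1 - a * IE1 := by linarith
  -- the certificate identity
  have hT : 0 ≤ e1 * e2 * (Ax * ((1 - t) * IW1 + t * IO) - ((1 - t) * a + t * o) * (IE1 + IF)) := by
    have hid : e1 * e2 * (Ax * ((1 - t) * IW1 + t * IO) - ((1 - t) * a + t * o) * (IE1 + IF)) =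
        t * e1 * (e2 * (Ax * IO - o * (IE1 + IF)) - b * (Ax * IF - mF * (IE1 + IF))) +
          (1 - t) * e2 * Ax * (e1 * IW1 - a * IE1) := by
      have hAx' : Ax = e1 + mF := hmD
      rw [hAx']
      linear_combination (e1 * IF - mF * IE1) * ht
    rw [hid]
    have h1 : 0 ≤ t * e1 * (e2 * (Ax * IO - o * (IE1 + IF)) - b * (Ax * IF - mF * (IE1 + IF))) :=
      mul_nonneg (mul_nonneg ht0 hE1.le) hH1
    have h2 : 0 ≤ (1 - t) * e2 * Ax * (e1 * IW1 - a * IE1) :=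
      mul_nonneg (mul_nonneg (mul_nonneg (by linarith) hE2.le) hAxnn) hH2
    linarith
  have hT' : 0 ≤ Ax * ((1 - t) * IW1 + t * IO) - ((1 - t) * a + t * o) * (IE1 + IF) := by
    have hpos : 0 < e1 * e2 := mul_pos hE1 hE2
    have h0 : e1 * e2 * 0 ≤ e1 * e2 * (Ax * ((1 - t) * IW1 + t * IO) - ((1 - t) * a + t * o) * (IE1 + IF)) := by
      rw [mul_zero]; exact hT
    exact le_of_mul_le_mul_left h0 hpos
  by_cases hAx0 : Ax = 0
  · have hμD : μ Dxz = 0 := (measureReal_eq_zero_iff (measure_ne_top _ _)).1 hAx0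
    have hsub : ∀ S : Set (BondConfig V), S ⊆ Dxz → ∫ ω in S, f ω ∂μ = 0 :=
      fun S hS => setIntegral_measure_zero _ (measure_mono_null hS hμD)
    have hOD : O ⊆ Dxz := by
      rintro ω ⟨⟨n, hn, hxn⟩, hz'⟩
      exact fun hxz' => hz' n hn (hxz'.symm.trans hxn)
    have z1 : IE1 = 0 := hsub E1 inter_subset_right
    have z2 : IF = 0 := hsub Fev inter_subset_right
    have z3 : IW1 = 0 := hsub W1 (hW1E1.trans inter_subset_right)
    have z4 : IO = 0 := hsub O hOD
    rw [z1, z2, z3, z4]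
    simp
  · have hAxpos : 0 < Ax := lt_of_le_of_ne hAxnn (Ne.symm hAx0)
    have hprod : Ax * (lam * (IE1 + IF)) = ((1 - t) * a + t * o) * (IE1 + IF) := by
      rw [← hlam]; ring
    have key : Ax * (lam * (IE1 + IF)) ≤ Ax * ((1 - t) * IW1 + t * IO) := by
      rw [hprod]; linarith
    exact le_of_mul_le_mul_left key hAxpos

end Q7Psi

end

end Summit.CriticalPhenomena.PercolationContinuityZ3.Theorems
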